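import Summits.ResolutionOfSingularities.ResolutionOfSingularities.Theorems.MarkedTransferCampaignW36ThreeLinesA4
import HarnessLib

/-!
# [OURS · L1 W3.6 / K3.6 specimen (B)] The cut `J = (w, xy, yz, zx) ⊂ k[x,y,z,w]` of specimen (B), part 2: `xyz ∈ J^{(2)} ∖ J²`
# (the ord-pow door FAILS) and VERONESE STABILITY AT LEVEL 2, `(J^{(2)})^m = J^{(2m)}`
# (companion of `MarkedTransferCampaignW36ThreeLinesA4.lean`)

Cell `res-hironaka`, rung L slot W3.6 «ORD-POW CUT» / kill test K3.6 specimen (B) (`E_B = ((w²) + (xy,yz,zx)^M·𝒪, 2) ⊂ 𝔸⁴`;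
res-adj-3 GAP-AMEND R12 12a 2026-08-27T01:1xZ «score (B) ALIVE-for-the-residual iff D_{2k} = D_2^k certifies»; res-type-010 K3.6
AMENDMENT 1 «(B) predicted level-2 core focus»). HOST: `Theses.MarkedTransfer.HypersurfaceOrderReduction`
(stmt-ResolutionOfSingularities-16155), `--supports … --as helper`. Author seat: res-type-009 (RESERVE), STATUS 2026-08-27T01:31:42Z.

HONEST FRAMING. Elementary commutative algebra about monomial ideals in `k[x,y,z,w]`; NOTHING here is a statement of H. Hironaka's
manuscript (2017, [Hironaka2017]) and no candidate statement of it is used as a premise. With the notation of part 1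
(`J = (X₃, X₀X₁, X₁X₂, X₀X₂)`, `J^{(n)} = symbPow n = (X₃,X₁,X₂)^n ∩ (X₃,X₀,X₂)^n ∩ (X₃,X₀,X₁)^n`):
* `X012_mem_symbPow_two`, `X012_not_mem_sq` — `xyz ∈ J^{(2)}` but `xyz ∉ J²` over a non-trivial `k` (every monomial of `J²` has
  weight `d₀+d₁+d₂+2d₃ ≥ 4`), hence `symbPow_two_ne_sq`: `J^{(2)} ≠ J²` and `not_symbPowJ_two_le_J_sq` — ordinary ≠ symbolic
  powers along the three concurrent lines: «OrdPowAlong» / ⟨OrdPowCut⟩ FAILS for specimen (B), as res-L1-type-o4 predicted;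
* **`symbPowJ_two_mul`** — `J^{(2m)} = (J^{(2)})^m` for every `m` (VERONESE STABILITY AT LEVEL `2`); `symbPowJ_two_mul_le_pow` is
  the «`𝓘^{⟨k·b₀⟩} ≤ (𝓘^{⟨b₀⟩})^k ∀ k`, `b₀ = 2`» hypothesis shape of `Lib/CoreFocusVeronese.stableAt_of_veronese` (res-type-010,
  p480948) at the ring level.
The SHEAF-level identification `diffPower C b = J^{(b)}·𝒪_{𝔸⁴}` and `StableAt E_B C 2` are NOT claimed here. AI-produced kernel
evidence, weaker than expert review.
-/

noncomputable section

set_option linter.dupNamespace false -- mandated namespace of this single-conjunct summit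

namespace Summit.ResolutionOfSingularities.ResolutionOfSingularities.Theorems

namespace CampaignW36

namespace ThreeLinesA4

open MvPolynomial
open scoped Pointwise

variable {k : Type*} [CommRing k]

/-- The exponent `(1,1,1,0)` of `xyz`. -/
def e111 : Fin 4 →₀ ℕ := Finsupp.single 0 1 + Finsupp.single 1 1 + Finsupp.single 2 1

/-- Coordinates of `(1,1,1,0)`. -/
@[simp] theorem e111_apply (l : Fin 4) : e111 l = if l = 3 then 0 else 1 := by
  fin_cases l <;> simp [e111]

/-- `xyz` as a monomial. -/
theorem X012_eq : (X 0 * X 1 * X 2 : R k) = monomial e111 1 := by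
  rw [e111, X, X, X, monomial_mul, monomial_mul, mul_one, mul_one]

/-- **`xyz ∈ J^{(2)}`**. -/
theorem X012_mem_symbPow_two : (X 0 * X 1 * X 2 : R k) ∈ symbPow 2 := by
  rw [X012_eq]
  exact monomial_mem_symbPow (by simp) (by simp) (by simp) 1

/-- The weight `d ↦ d₀ + d₁ + d₂ + 2·d₃` (`w` counts double): every generator of `J` has weight `2`. -/
def jWeight : (Fin 4 →₀ ℕ) →+ ℕ :=
  Finsupp.applyAddHom 0 + Finsupp.applyAddHom 1 + Finsupp.applyAddHom 2 + 2 • Finsupp.applyAddHom 3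

/-- `jWeight d = d₀ + d₁ + d₂ + 2·d₃`. -/
@[simp] theorem jWeight_apply (d : Fin 4 →₀ ℕ) : jWeight d = d 0 + d 1 + d 2 + 2 * d 3 := by
  simp [jWeight]

/-- `J ⊆ W_j(2)`. -/
theorem J_le_wIdeal_two : J (k := k) ≤ wIdeal jWeight 2 := by
  rw [J, Ideal.span_le]
  intro f hf
  simp only [Set.mem_insert_iff, Set.mem_singleton_iff] at hf
  rw [SetLike.mem_coe]
  rcases hf with rfl | rfl | rfl | rfl
  · have hX : (X 3 : R k) = monomial (Finsupp.single 3 1) 1 := rfl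
    rw [hX]; exact monomial_mem_wIdeal (by simp) 1
  · rw [X_mul_X_eq]; exact monomial_mem_wIdeal (by simp) 1
  · rw [X_mul_X_eq]; exact monomial_mem_wIdeal (by simp) 1
  · rw [X_mul_X_eq]; exact monomial_mem_wIdeal (by simp) 1

/-- **`xyz ∉ J²`** (non-trivial `k`): every monomial of `J²` has `j`-weight `≥ 4`, `xyz` has `j`-weight `3`. Hence ordinary square ≠
symbolic square: «OrdPowAlong» FAILS for the cut of specimen (B). -/
theorem X012_not_mem_sq [Nontrivial k] : (X 0 * X 1 * X 2 : R k) ∉ J ^ 2 := by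
  intro h
  have h4 : (X 0 * X 1 * X 2 : R k) ∈ wIdeal jWeight 4 := by
    have hle : J (k := k) ^ 2 ≤ wIdeal jWeight (2 * 2) :=
      le_trans (Ideal.pow_right_mono J_le_wIdeal_two 2) (wIdeal_pow_le jWeight 2 2)
    exact hle h
  rw [X012_eq] at h4
  have := le_of_monomial_mem_wIdeal one_ne_zero h4
  simp at this

/-- **`J^{(2)} ≠ J²`** (non-trivial `k`). -/
theorem symbPow_two_ne_sq [Nontrivial k] : symbPow (k := k) 2 ≠ J ^ 2 := fun h =>
  X012_not_mem_sq (h ▸ X012_mem_symbPow_two)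

/-! ## Veronese stability at level 2: `(J^{(2)})^m = J^{(2m)}` -/

/-- One peeling step: if `X^e ∈ J^{(2)}`, `e ≤ d` and `X^{d−e} ∈ (J^{(2)})^m` then `X^d ∈ (J^{(2)})^{m+1}`. -/
theorem peel {m : ℕ} {d : Fin 4 →₀ ℕ} (e : Fin 4 →₀ ℕ) (he : monomial e (1 : k) ∈ symbPow 2) (hle : e ≤ d)
    (ih : monomial (d - e) (1 : k) ∈ symbPow 2 ^ m) : monomial d (1 : k) ∈ symbPow 2 ^ (m + 1) := by
  rw [monomial_eq_mul_of_le hle, pow_succ']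
  exact Ideal.mul_mem_mul he ih

set_option linter.unnecessarySeqFocus false in -- uniform `<;>` chains over `fin_cases` (some branches close early)
/-- A monomial of `J^{(2m)}` lies in `(J^{(2)})^m`: peel `w²` while `d₃ ≥ 2`, `w·X_iX_j` when `d₃ = 1`, `xyz` when `d₃ = 0` and
`x,y,z` all occur, else a square `(X_iX_j)²` — each peeled factor lies in `J^{(2)}` and the cofactor in `J^{(2(m−1))}`. -/
theorem monomial_mem_symbPow_two_pow :
    ∀ (m : ℕ) (d : Fin 4 →₀ ℕ), 2 * m ≤ d 3 + d 1 + d 2 → 2 * m ≤ d 3 + d 0 + d 2 → 2 * m ≤ d 3 + d 0 + d 1 →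
      monomial d (1 : k) ∈ symbPow 2 ^ m := by
  classical
  intro m
  induction m with
  | zero => intro d _ _ _; simp
  | succ m ih =>
    intro d h1 h2 h3
    -- generic peeling with an explicit exponent `e`
    have go : ∀ e : Fin 4 →₀ ℕ, monomial e (1 : k) ∈ symbPow 2 → e ≤ d →
        2 * m ≤ (d - e) 3 + (d - e) 1 + (d - e) 2 → 2 * m ≤ (d - e) 3 + (d - e) 0 + (d - e) 2 →
        2 * m ≤ (d - e) 3 + (d - e) 0 + (d - e) 1 → monomial d (1 : k) ∈ symbPow 2 ^ (m + 1) :=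
      fun e he hle k1 k2 k3 => peel e he hle (ih (d - e) k1 k2 k3)
    by_cases hw2 : 2 ≤ d 3
    · -- peel `w²`
      refine go (Finsupp.single 3 2) (monomial_mem_symbPow (by simp) (by simp) (by simp) 1)
        (fun l => by fin_cases l <;> simp <;> omega) ?_ ?_ ?_ <;>
        simp only [Finsupp.coe_tsub, Pi.sub_apply, Finsupp.single_apply] <;> simp <;> omega
    · by_cases hw1 : d 3 = 1
      · -- peel `w · X_i X_j` for a pair with `d_i + d_j ≥ 2m+2`, `d_i, d_j ≥ 1` (exists by parity)
        have hpair : (2 * m + 2 ≤ d 0 + d 1 ∧ 1 ≤ d 0 ∧ 1 ≤ d 1) ∨ (2 * m + 2 ≤ d 1 + d 2 ∧ 1 ≤ d 1 ∧ 1 ≤ d 2) ∨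
            (2 * m + 2 ≤ d 0 + d 2 ∧ 1 ≤ d 0 ∧ 1 ≤ d 2) := by omega
        rcases hpair with ⟨hs, hi, hj⟩ | ⟨hs, hi, hj⟩ | ⟨hs, hi, hj⟩
        · refine go (Finsupp.single 3 1 + Finsupp.single 0 1 + Finsupp.single 1 1)
            (monomial_mem_symbPow (by simp) (by simp) (by simp) 1) (fun l => by fin_cases l <;> simp <;> omega) ?_ ?_ ?_ <;>
            simp only [Finsupp.coe_tsub, Finsupp.coe_add, Pi.sub_apply, Pi.add_apply, Finsupp.single_apply] <;> simp <;> omega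
        · refine go (Finsupp.single 3 1 + Finsupp.single 1 1 + Finsupp.single 2 1)
            (monomial_mem_symbPow (by simp) (by simp) (by simp) 1) (fun l => by fin_cases l <;> simp <;> omega) ?_ ?_ ?_ <;>
            simp only [Finsupp.coe_tsub, Finsupp.coe_add, Pi.sub_apply, Pi.add_apply, Finsupp.single_apply] <;> simp <;> omega
        · refine go (Finsupp.single 3 1 + Finsupp.single 0 1 + Finsupp.single 2 1)
            (monomial_mem_symbPow (by simp) (by simp) (by simp) 1) (fun l => by fin_cases l <;> simp <;> omega) ?_ ?_ ?_ <;>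
            simp only [Finsupp.coe_tsub, Finsupp.coe_add, Pi.sub_apply, Pi.add_apply, Finsupp.single_apply] <;> simp <;> omega
      · have hw0 : d 3 = 0 := by omega
        by_cases hpos : 1 ≤ d 0 ∧ 1 ≤ d 1 ∧ 1 ≤ d 2
        · -- peel `xyz`
          refine go e111 X012_mem_symbPow_two_mono (fun l => by fin_cases l <;> simp <;> omega) ?_ ?_ ?_ <;>
            simp only [Finsupp.coe_tsub, Pi.sub_apply, e111_apply] <;> simp <;> omega
        · -- one of `x,y,z` is absent: the other two are `≥ 2m+2`; peel the square of their product
          by_cases h0 : d 0 = 0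
          · refine go (Finsupp.single 1 2 + Finsupp.single 2 2) (monomial_mem_symbPow (by simp) (by simp) (by simp) 1)
              (fun l => by fin_cases l <;> simp <;> omega) ?_ ?_ ?_ <;>
              simp only [Finsupp.coe_tsub, Finsupp.coe_add, Pi.sub_apply, Pi.add_apply, Finsupp.single_apply] <;> simp <;> omega
          · by_cases h1' : d 1 = 0
            · refine go (Finsupp.single 0 2 + Finsupp.single 2 2) (monomial_mem_symbPow (by simp) (by simp) (by simp) 1)
                (fun l => by fin_cases l <;> simp <;> omega) ?_ ?_ ?_ <;>
                simp only [Finsupp.coe_tsub, Finsupp.coe_add, Pi.sub_apply, Pi.add_apply, Finsupp.single_apply] <;> simp <;>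
                omega
            · refine go (Finsupp.single 0 2 + Finsupp.single 1 2) (monomial_mem_symbPow (by simp) (by simp) (by simp) 1)
                (fun l => by fin_cases l <;> simp <;> omega) ?_ ?_ ?_ <;>
                simp only [Finsupp.coe_tsub, Finsupp.coe_add, Pi.sub_apply, Pi.add_apply, Finsupp.single_apply] <;> simp <;>
                omega
  where
  /-- `xyz ∈ J^{(2)}` in monomial form (used inside the induction). -/
  X012_mem_symbPow_two_mono : monomial e111 (1 : k) ∈ symbPow 2 := X012_eq (k := k) ▸ X012_mem_symbPow_two

/-- **VERONESE STABILITY AT LEVEL 2 for the cut of specimen (B): `J^{(2m)} = (J^{(2)})^m`** for every `m` (stated with the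
symbolic power on the left; the `k[x,y,z]` file states its analogue the other way round). -/
theorem symbPowJ_two_mul (m : ℕ) : symbPow (k := k) (2 * m) = symbPow 2 ^ m := by
  refine le_antisymm (symbPow_le_of_monomial_mem fun d h1 h2 h3 => monomial_mem_symbPow_two_pow m d h1 h2 h3) ?_
  rw [mul_comm]
  exact symbPow_pow_le 2 m

/-- The same in the «`J^{(N·b)} ≤ (J^{(N)})^b`, `N = 2`» shape of `Lib/CoreFocusVeronese.stableAt_of_veronese` (for the cut `J`
of specimen (B) in `k[x,y,z,w]`). -/
theorem symbPowJ_two_mul_le_pow (b : ℕ) : symbPow (k := k) (2 * b) ≤ symbPow 2 ^ b :=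
  (symbPowJ_two_mul b).le

/-- Level `1` is NOT stable for the cut `J`: `J^{(2)} ⊄ J² = (J^{(1)})²` (non-trivial `k`). -/
theorem not_symbPowJ_two_le_J_sq [Nontrivial k] : ¬ symbPow (k := k) 2 ≤ J ^ 2 :=
  fun h => X012_not_mem_sq (h X012_mem_symbPow_two)

end ThreeLinesA4

end CampaignW36

end Summit.ResolutionOfSingularities.ResolutionOfSingularities.Theorems

end
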